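import Literature.Analysis.FluidPDE.PeriodicLerayGalerkin
import Literature.Analysis.FluidPDE.PeriodicLerayGalerkinIdentity
import Literature.Analysis.FluidPDE.PeriodicLerayGalerkinLimitVelocity
import Literature.Analysis.FluidPDE.PeriodicLerayGalerkinLimitWeakForm
import Literature.Analysis.FluidPDE.PeriodicLerayGalerkinLimitClosure
import Literature.Analysis.FluidPDE.PeriodicLerayGalerkinTestApprox
import Literature.Analysis.FluidPDE.PeriodicLerayTestPeriodization
import Literature.Analysis.FluidPDE.PeriodicLerayPolarizedIdentities
import Literature.Analysis.FluidPDE.PeriodicLerayRieszPressure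
import Literature.Analysis.FluidPDE.PeriodicLerayLocalEnergyBalance
import Literature.Analysis.FluidPDE.PeriodicLerayExistenceLimitProofs
import HarnessLib

/-!
# [BT1] Theorem 2.4, the mollified periodic Leray solutions: discharge of `thm_2_4_mollified`

Analysis/FluidPDE proof file (theorems only; no definitions, no named facts). It discharges the
named fact `Literature.Analysis.FluidPDE.bradshawTsai2017_thm_2_4_mollified`
(`PeriodicLerayExistence.lean`; Bradshaw–Tsai, Ann. Henri Poincaré 18 (2017) = arXiv:1510.07504
[BT1], proof of Thm 2.4 up to the limit `ε → 0`: for every `ε > 0` the mollified perturbed Leray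
system has a `T`-periodic weak solution with bounds independent of `ε`), assembling:
the Galerkin approximations of [BT1] Lemma 2.6 (`bradshawTsai2017_lemma_2_6`), their compactness
and Galerkin limit (`PeriodicLerayGalerkinCompactness`, `…GalerkinLimitVelocity`,
`PeriodicLerayLimitGradient`), the passage to the limit in the weak formulation
(`…GalerkinIdentity`, `…GalerkinLimitWeakForm`, `…GalerkinTestApprox`, `…GalerkinLimitClosure`),
the periodic representatives (`PeriodicLerayLimitPeriodicity`), the line weak form and the very
weak form (`PeriodicLerayTestPeriodization`, `PeriodicLerayPolarizedIdentities`), the Riesz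
pressure (`PeriodicLerayRieszPressure`) and the distributional formulation
(`MollifiedLerayDistributional`), the Stokes form and the local energy balance
(`PeriodicLerayLocalEnergyBalance`).

## References

* Z. Bradshaw, T.-P. Tsai, Ann. Henri Poincaré 18 (2017) = arXiv:1510.07504, Lemma 2.6 and proof
  of Thm 2.4 [BradshawTsai2017AHP].
* R. Temam, *Navier–Stokes equations* (1977/79), Ch. III §§2–3 [Temam1979].
-/

noncomputable section

open MeasureTheory Set Function Filter Topology TopologicalSpace Metric ContinuousLinearMap
open scoped NNReal ENNReal InnerProductSpace RealInnerProductSpace Convolution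

namespace Literature.Analysis.FluidPDE

namespace BradshawTsai2017

/-! ### The tested integrand of clause (iii) for the Galerkin approximants -/

section SliceIdentity

variable {W : ℝ → EuclideanSpace ℝ (Fin 3) → EuclideanSpace ℝ (Fin 3)} {ρ : EuclideanSpace ℝ (Fin 3) → ℝ}
  {k : ℕ} {a : Fin k → EuclideanSpace ℝ (Fin 3) → EuclideanSpace ℝ (Fin 3)}

/-- **The tested integrand of clause (iii) for a Galerkin field equals the Galerkin form**: for
`U = Σᵢ cᵢ aᵢ` (a test field), a test field `g`, a continuous `τ` and a `C¹` slice `W(s)`,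
`∫ (⟪U, τ⟫ − ∇U:∇g + ⟪U + (∇U)y − (∇U)(W + ρ*U) − DW U − DW W, g⟫) − ⟨LW(s), g⟩
  = ∫⟪U, τ⟫ + RHS(s; U, g)` (`RHS = galerkinForm W ρ s U g`), by the definitions of
`galerkinLinear`, `galerkinTrilinear`, `galerkinSource`. [cite: BradshawTsai2017AHP, §2 (weak formulation of the mollified perturbed Leray system)] -/
theorem clauseIII_integrand_eq_galerkinForm (hW : ContDiff ℝ 1 (uncurry W)) (hρ : Continuous ρ)
    (hρc : HasCompactSupport ρ)
    (ha : ∀ i, FunctionSpaces.IsTestFunctionOn (⊤ : Opens (EuclideanSpace ℝ (Fin 3))) (a i))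
    (c : EuclideanSpace ℝ (Fin k)) {g : EuclideanSpace ℝ (Fin 3) → EuclideanSpace ℝ (Fin 3)}
    (hg : FunctionSpaces.IsTestFunctionOn (⊤ : Opens (EuclideanSpace ℝ (Fin 3))) g)
    {τ : EuclideanSpace ℝ (Fin 3) → EuclideanSpace ℝ (Fin 3)} (hτ : Continuous τ) (s : ℝ) :
    (∫ y, (⟪galerkinSum a c y, τ y⟫ -
        frobeniusInner (fderiv ℝ (galerkinSum a c) y) (fderiv ℝ g y) +
        ⟪galerkinSum a c y + fderiv ℝ (galerkinSum a c) y y -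
          fderiv ℝ (galerkinSum a c) y (W s y +
            (ρ ⋆[ContinuousLinearMap.lsmul ℝ ℝ, volume] galerkinSum a c) y) -
          fderiv ℝ (W s) y (galerkinSum a c y) - fderiv ℝ (W s) y (W s y), g y⟫)) -
      lerayPairing W s g =
    (∫ y, ⟪galerkinSum a c y, τ y⟫) + galerkinForm W ρ s (galerkinSum a c) g := by
  have hU : FunctionSpaces.IsTestFunctionOn (⊤ : Opens (EuclideanSpace ℝ (Fin 3))) (galerkinSum a c) :=
    isTestFunctionOn_galerkinSum ha c
  have hU1 : ContDiff ℝ 1 (galerkinSum a c) := hU.contDiff.of_le (by exact_mod_cast le_top)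
  have hg1 : ContDiff ℝ 1 g := hg.contDiff.of_le (by exact_mod_cast le_top)
  have hSR : SliceRegular W s := SliceRegular.of_contDiff hW s
  have cWs : Continuous (W s) := hSR.continuous
  have cDWs : Continuous fun y => fderiv ℝ (W s) y := hSR.continuous_fderiv
  -- the four integrable pieces
  have i0 : Integrable (fun y => ⟪galerkinSum a c y, τ y⟫) (volume : Measure (EuclideanSpace ℝ (Fin 3))) :=
    (hU.contDiff.continuous.inner hτ).integrable_of_hasCompactSupport
      (HasCompactSupport.intro hU.hasCompactSupport fun y hy => by
        rw [image_eq_zero_of_notMem_tsupport hy, inner_zero_left])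
  have i1 : Integrable (linearIntegrand W s (galerkinSum a c) g) (volume : Measure (EuclideanSpace ℝ (Fin 3))) :=
    integrable_linearIntegrand hU1 hg1 hg.hasCompactSupport cWs cDWs
  have i2 : Integrable (fun y => ⟪fderiv ℝ (galerkinSum a c) y
      ((ρ ⋆[ContinuousLinearMap.lsmul ℝ ℝ, volume] galerkinSum a c) y), g y⟫)
      (volume : Measure (EuclideanSpace ℝ (Fin 3))) :=
    integrable_trilinearIntegrand hρ hρc hU.contDiff.continuous hU1 hg.contDiff.continuous hg.hasCompactSupport
  have i3 : Integrable (fun y => ⟪fderiv ℝ (W s) y (W s y), g y⟫) (volume : Measure (EuclideanSpace ℝ (Fin 3))) :=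
    ((cDWs.clm_apply cWs).inner hg.contDiff.continuous).integrable_of_hasCompactSupport
      (HasCompactSupport.intro hg.hasCompactSupport fun y hy => by
        rw [image_eq_zero_of_notMem_tsupport hy, inner_zero_right])
  -- the integrand, rewritten
  have hpt : ∀ y, ⟪galerkinSum a c y, τ y⟫ -
        frobeniusInner (fderiv ℝ (galerkinSum a c) y) (fderiv ℝ g y) +
        ⟪galerkinSum a c y + fderiv ℝ (galerkinSum a c) y y -
          fderiv ℝ (galerkinSum a c) y (W s y +
            (ρ ⋆[ContinuousLinearMap.lsmul ℝ ℝ, volume] galerkinSum a c) y) -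
          fderiv ℝ (W s) y (galerkinSum a c y) - fderiv ℝ (W s) y (W s y), g y⟫ =
      ⟪galerkinSum a c y, τ y⟫ + linearIntegrand W s (galerkinSum a c) g y -
        ⟪fderiv ℝ (galerkinSum a c) y ((ρ ⋆[ContinuousLinearMap.lsmul ℝ ℝ, volume] galerkinSum a c) y), g y⟫ -
        ⟪fderiv ℝ (W s) y (W s y), g y⟫ := by
    intro y
    simp only [linearIntegrand, map_add, inner_sub_left, inner_add_left]
    ring
  have s01 : Integrable (fun y => ⟪galerkinSum a c y, τ y⟫ + linearIntegrand W s (galerkinSum a c) g y)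
      (volume : Measure (EuclideanSpace ℝ (Fin 3))) := i0.add i1
  have s012 : Integrable (fun y => ⟪galerkinSum a c y, τ y⟫ + linearIntegrand W s (galerkinSum a c) g y -
      ⟪fderiv ℝ (galerkinSum a c) y ((ρ ⋆[ContinuousLinearMap.lsmul ℝ ℝ, volume] galerkinSum a c) y), g y⟫)
      (volume : Measure (EuclideanSpace ℝ (Fin 3))) := s01.sub i2
  rw [integral_congr_ae (ae_of_all _ hpt), integral_sub s012 i3, integral_sub s01 i2, integral_add i0 i1,
    galerkinForm_apply]
  simp only [galerkinLinear, galerkinTrilinear, galerkinSource]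
  ring

end SliceIdentity

/-! ### The packaging: from the limit data to a periodic weak solution of the mollified system -/

section Packaging

set_option maxHeartbeats 3200000 in
/-- **Packaging a `T`-periodic field with the a priori bounds and the periodic weak formulation
into a weak solution of the mollified perturbed Leray system** ([BT1], proof of Thm 2.4:
the limit `U_ε` of the Galerkin approximations is a periodic weak solution of the mollified
perturbed Leray system, with pressure given by the Riesz transforms, satisfying the a priori
bounds; and "the approximating solutions `(u_ε, p_ε)` all satisfy the local energy equality").
Given a `T`-periodic, jointly measurable `U` with measurable slices of energy `≤ C_b` for every
`s`, a `T`-periodic weak spatial gradient `G` with `∫∫_{(0,T)×ℝ³} |G|² ≤ C_b`, a.e. weakly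
divergence-free slices and the weak formulation (iii) against `𝒟_T`, the Riesz pressure of
`exists_rieszPressure` makes `(U, p)` an `IsMollifiedPeriodicWeakSolution` for every constant
dominating `C_b` and the pressure bound: line weak form (`weakForm_line_of_period`), very weak
form (`veryWeak_of_lineWeakForm`), distributional formulation (`distributional_of_veryWeak_slices`),
Stokes form (`stokesForm_of_distributional`), local energy balance
(`local_energy_balance_iterated`). [cite: BradshawTsai2017AHP, proof of Thm 2.4 (the Galerkin limit is a periodic weak solution with Riesz pressure; local energy equality of the approximants)] -/
theorem exists_pressure_isMollifiedPeriodicWeakSolution :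
    ∃ Cp : ℝ≥0∞, Cp ≠ ⊤ ∧ ∀ {T : ℝ}, 0 < T → ∀ {α : ℝ}, 0 ≤ α →
      ∀ {W : ℝ → EuclideanSpace ℝ (Fin 3) → EuclideanSpace ℝ (Fin 3)}, IsRevisedProfile T (10 / 3) α W →
      ∀ {η : EuclideanSpace ℝ (Fin 3) → ℝ}, IsMollifyingKernel η → ∀ {ε : ℝ}, 0 < ε →
      ∀ {U : ℝ → EuclideanSpace ℝ (Fin 3) → EuclideanSpace ℝ (Fin 3)} {G : ℝ → EuclideanSpace ℝ (Fin 3) → EuclideanSpace ℝ (Fin 3) →L[ℝ] EuclideanSpace ℝ (Fin 3)} {Cb Cx : ℝ≥0},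
      AEStronglyMeasurable (uncurry U) volume →
      (∀ s, AEStronglyMeasurable (U s) (volume : Measure (EuclideanSpace ℝ (Fin 3)))) →
      (∀ s y, U (s + T) y = U s y) → (∀ s y, G (s + T) y = G s y) →
      (∀ s, ∫⁻ y, ‖U s y‖ₑ ^ 2 ≤ Cb) →
      HasWeakSpatialGradientOn (⊤ : Opens (ℝ × EuclideanSpace ℝ (Fin 3))) U G →
      (∫⁻ z in Ioo 0 T ×ˢ (univ : Set (EuclideanSpace ℝ (Fin 3))), ENNReal.ofReal (frobeniusNormSq (G z.1 z.2)) ≤ Cb) →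
      (∀ᵐ s : ℝ, IsWeaklyDivFree (U s)) →
      (∀ f : ℝ → EuclideanSpace ℝ (Fin 3) → EuclideanSpace ℝ (Fin 3), IsPeriodicDivFreeTest T f →
        ∫ s in Ioo 0 T, ((∫ y, (⟪U s y, timeDeriv f s y⟫ -
            frobeniusInner (G s y) (fderiv ℝ (f s) y) +
            ⟪U s y + G s y y - G s y (W s y + mollify η ε U s y) -
              fderiv ℝ (W s) y (U s y) - fderiv ℝ (W s) y (W s y), f s y⟫)) -
          lerayPairing W s (f s)) = 0) →
      (Cb : ℝ≥0∞) ≤ Cx →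
      Cp * (((Cb : ℝ≥0∞) ^ (2 / 3 : ℝ) * ((SNormLESNormFDerivOfEqConst (EuclideanSpace ℝ (Fin 3)) (volume : Measure (EuclideanSpace ℝ (Fin 3))) 2 : ℝ≥0∞) ^ 2 * Cb)) + ENNReal.ofReal T * ENNReal.ofReal α ^ (10 / 3 : ℝ) +
          (∫⁻ y, ‖η y‖ₑ) ^ (10 / 3 : ℝ) * ((Cb : ℝ≥0∞) ^ (2 / 3 : ℝ) * ((SNormLESNormFDerivOfEqConst (EuclideanSpace ℝ (Fin 3)) (volume : Measure (EuclideanSpace ℝ (Fin 3))) 2 : ℝ≥0∞) ^ 2 * Cb))) ≤ Cx →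
      ∃ p : ℝ → EuclideanSpace ℝ (Fin 3) → ℝ, IsMollifiedPeriodicWeakSolution T W η ε Cx U p := by
  obtain ⟨Cp, hCp, hRP⟩ := exists_rieszPressure
  refine ⟨Cp, hCp, ?_⟩
  intro T hT α hα0 W hWr η hη ε hε U G Cb Cx hUm hUsm hUper hGper hUE hG hGb hdiv hiii hCx1 hCx2
  have happ : Continuous (uncurry fun (L : EuclideanSpace ℝ (Fin 3) →L[ℝ] EuclideanSpace ℝ (Fin 3)) (v : EuclideanSpace ℝ (Fin 3)) => L v) :=
    isBoundedBilinearMap_apply.continuous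
  have hWc1 : ContDiff ℝ 1 (uncurry W) := hWr.contDiff
  have hWper : ∀ s y, W (s + T) y = W s y := hWr.periodic
  have hdivW : ∀ s, VectorCalculus.IsDivFree (W s) := hWr.divFree
  have cW : Continuous fun z : ℝ × EuclideanSpace ℝ (Fin 3) => W z.1 z.2 := hWc1.continuous
  have cDW : Continuous fun z : ℝ × EuclideanSpace ℝ (Fin 3) => fderiv ℝ (W z.1) z.2 := continuous_fderiv_slice_of_contDiff hWc1
  have hWm : AEStronglyMeasurable (uncurry W) (volume : Measure (ℝ × EuclideanSpace ℝ (Fin 3))) := hWc1.continuous.aestronglyMeasurable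
  ------------------------------------------------------------------
  -- ## classes of `U`, `G`
  ------------------------------------------------------------------
  have hUli : LocallyIntegrable (uncurry U) volume := by
    have h := hG.locallyIntegrableOn
    rw [TopologicalSpace.Opens.coe_top] at h
    exact locallyIntegrableOn_univ.1 h
  have hGli : LocallyIntegrable (uncurry G) volume := by
    have h := hG.locallyIntegrableOn_grad
    rw [TopologicalSpace.Opens.coe_top] at h
    exact locallyIntegrableOn_univ.1 h
  have hGm : AEStronglyMeasurable (uncurry G) volume := hGli.aestronglyMeasurable
  have hUslab : ∀ a b : ℝ, MemLp (uncurry U) 2 (volume.restrict (Icc a b ×ˢ (univ : Set (EuclideanSpace ℝ (Fin 3))))) :=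
    memLp_slab_of_forall_lintegral_le hUm two_ne_zero ENNReal.ofNat_ne_top ENNReal.coe_ne_top
      (fun s => by rw [ENNReal.toReal_ofNat]; exact_mod_cast hUE s)
  obtain ⟨-, hU2loc⟩ := locallyIntegrable_and_sq_of_memLp_slab le_rfl hUslab
  have hU2loc' : LocallyIntegrable (fun z : ℝ × EuclideanSpace ℝ (Fin 3) => ‖U z.1 z.2‖ ^ 2) volume := hU2loc
  have hUs2 : ∀ s, MemLp (U s) 2 (volume : Measure (EuclideanSpace ℝ (Fin 3))) := fun s => by
    refine ⟨hUsm s, ?_⟩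
    rw [FunctionSpaces.AubinLions.eLpNorm_two_eq_rpow]
    exact ENNReal.rpow_lt_top_of_nonneg (by norm_num) ((hUE s).trans_lt ENNReal.coe_lt_top).ne
  have hUsli : ∀ s, LocallyIntegrable (U s) (volume : Measure (EuclideanSpace ℝ (Fin 3))) := fun s => (hUs2 s).locallyIntegrable one_le_two
  -- `|G|²_F` is locally integrable (window bound and periodicity)
  have hG2loc : LocallyIntegrable (fun z : ℝ × EuclideanSpace ℝ (Fin 3) => frobeniusNormSq (G z.1 z.2)) volume := by
    refine locallyIntegrable_iff.2 fun K hK => ?_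
    obtain ⟨a, b, hKab⟩ := exists_subset_Icc_prod_univ_of_isCompact hK
    have hsub : K ⊆ Ioo (a - 1) (b + 1) ×ˢ (univ : Set (EuclideanSpace ℝ (Fin 3))) := fun z hz =>
      ⟨⟨by linarith [(hKab hz).1.1], by linarith [(hKab hz).1.2]⟩, mem_univ _⟩
    have hwin := lintegral_window_gradient_le hG hT hUper hGb (a - 1) (b + 1)
    have hfin : ∫⁻ z in K, ENNReal.ofReal (frobeniusNormSq (G z.1 z.2)) < ⊤ :=
      ((lintegral_mono_set hsub).trans hwin).trans_lt (ENNReal.mul_lt_top (ENNReal.mul_lt_top ENNReal.ofNat_lt_top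
        (ENNReal.natCast_lt_top _)) ENNReal.coe_lt_top)
    have hmeas : AEStronglyMeasurable (fun z : ℝ × EuclideanSpace ℝ (Fin 3) => frobeniusNormSq (G z.1 z.2)) (volume.restrict K) :=
      (LerayHopfProofs.continuous_frobeniusNormSq.comp_aestronglyMeasurable hGm).restrict
    exact ⟨hmeas, (hasFiniteIntegral_iff_ofReal (ae_of_all _ fun z => frobeniusNormSq_nonneg _)).2 hfin⟩
  ------------------------------------------------------------------
  -- ## the mollified drift
  ------------------------------------------------------------------
  have hVm : AEStronglyMeasurable (uncurry (mollify η ε U)) (volume : Measure (ℝ × EuclideanSpace ℝ (Fin 3))) :=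
    hη.aestronglyMeasurable_mollify ε hUm
  have hV1 : ∀ s, ContDiff ℝ 1 (mollify η ε U s) := fun s => contDiff_mollify_slice hη hε (hUsli s)
  set Kη : ℝ := (eLpNorm (BradshawTsai2019.scaledMollifier η ε) 2 (volume : Measure (EuclideanSpace ℝ (Fin 3))) *
    (Cb : ℝ≥0∞) ^ (1 / 2 : ℝ)).toReal with hKη
  have hVb : ∀ s y, ‖mollify η ε U s y‖ ≤ Kη := fun s y => norm_mollify_le_of_energy hη hε (hUsm s) (hUE s) y
  have hVper : ∀ s y, mollify η ε U (s + T) y = mollify η ε U s y := fun s y => by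
    rw [mollify_add_period hUper s]
  have hdivV : ∀ᵐ z : ℝ × EuclideanSpace ℝ (Fin 3), VectorCalculus.divergence (mollify η ε U z.1) z.2 = 0 := by
    have hs : ∀ᵐ s : ℝ, ∀ y, VectorCalculus.divergence (mollify η ε U s) y = 0 := by
      filter_upwards [hdiv] with s hs y
      exact divergence_mollify_eq_zero hη hε (hUsli s) hs y
    have h := (Measure.quasiMeasurePreserving_fst (μ := (volume : Measure ℝ))
      (ν := (volume : Measure (EuclideanSpace ℝ (Fin 3))))).ae hs
    rw [← Measure.volume_eq_prod] at h
    exact h.mono fun z hz => hz z.2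
  have hVE : ∀ s, ∫⁻ y, ‖mollify η ε U s y‖ₑ ^ 2 ≤ (∫⁻ y, ‖η y‖ₑ) ^ (2 : ℝ) * Cb := by
    intro s
    have h := lintegral_mollify_rpow_le hη hε (U := U) (s := s) (hUsm s) (q := 2) (by norm_num)
    simp only [ENNReal.rpow_two] at h
    refine h.trans ?_
    rw [← ENNReal.rpow_two]
    exact mul_le_mul' le_rfl (hUE s)
  have hCV : (∫⁻ y, ‖η y‖ₑ) ^ (2 : ℝ) * (Cb : ℝ≥0∞) ≠ ⊤ :=
    ENNReal.mul_ne_top (ENNReal.rpow_ne_top_of_nonneg (by norm_num) hη.lintegral_enorm_lt_top.ne) ENNReal.coe_ne_top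
  ------------------------------------------------------------------
  -- ## the lower-order field of the line weak form
  ------------------------------------------------------------------
  have hbm : AEStronglyMeasurable (fun z : ℝ × EuclideanSpace ℝ (Fin 3) => W z.1 z.2 + mollify η ε U z.1 z.2) volume :=
    cW.aestronglyMeasurable.add hVm
  have hFli : LocallyIntegrable (uncurry fun s y => U s y + G s y y - G s y (W s y + mollify η ε U s y) -
      fderiv ℝ (W s) y (U s y) - fderiv ℝ (W s) y (W s y)) volume := by
    have h1 : LocallyIntegrable (fun z : ℝ × EuclideanSpace ℝ (Fin 3) => G z.1 z.2 z.2) volume :=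
      locallyIntegrable_opField_apply hGli continuous_snd.aestronglyMeasurable fun K' hK' => by
        obtain ⟨R', hR'⟩ := hK'.isBounded.exists_norm_le
        exact ⟨R', fun z hz => (norm_snd_le z).trans (hR' z hz)⟩
    have h2 : LocallyIntegrable (fun z : ℝ × EuclideanSpace ℝ (Fin 3) => G z.1 z.2 (W z.1 z.2 + mollify η ε U z.1 z.2)) volume :=
      locallyIntegrable_opField_apply hGli hbm fun K' hK' => by
        obtain ⟨M', hM'⟩ := hK'.exists_bound_of_continuousOn cW.continuousOn
        exact ⟨M' + Kη, fun z hz => (norm_add_le _ _).trans (add_le_add (hM' z hz) (hVb _ _))⟩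
    have h3 : LocallyIntegrable (fun z : ℝ × EuclideanSpace ℝ (Fin 3) => fderiv ℝ (W z.1) z.2 (U z.1 z.2)) volume :=
      locallyIntegrable_opField_apply_of_continuous cDW hUli
    have h4 : LocallyIntegrable (fun z : ℝ × EuclideanSpace ℝ (Fin 3) => fderiv ℝ (W z.1) z.2 (W z.1 z.2)) volume :=
      (happ.comp (cDW.prodMk cW)).locallyIntegrable
    exact (((hUli.add h1).sub h2).sub h3).sub h4
  have hFper : ∀ s y, (U (s + T) y + G (s + T) y y - G (s + T) y (W (s + T) y + mollify η ε U (s + T) y) -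
      fderiv ℝ (W (s + T)) y (U (s + T) y) - fderiv ℝ (W (s + T)) y (W (s + T) y)) =
      U s y + G s y y - G s y (W s y + mollify η ε U s y) - fderiv ℝ (W s) y (U s y) - fderiv ℝ (W s) y (W s y) := by
    intro s y
    rw [hUper, hGper, hWper, hVper, show W (s + T) = W s from funext (hWper s)]
  ------------------------------------------------------------------
  -- ## the line weak form, the very weak form
  ------------------------------------------------------------------
  have hline := fun (ψ : ℝ → EuclideanSpace ℝ (Fin 3) → EuclideanSpace ℝ (Fin 3)) (hψ : IsSpaceTimeTestOn (⊤ : Opens (ℝ × EuclideanSpace ℝ (Fin 3))) ψ)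
      (hψdiv : ∀ t, VectorCalculus.IsDivFree (ψ t)) =>
    weakForm_line_of_period (U := U) (G := G)
      (F := fun s y => U s y + G s y y - G s y (W s y + mollify η ε U s y) -
        fderiv ℝ (W s) y (U s y) - fderiv ℝ (W s) y (W s y))
      hT hUli hUper hGli hGper hFli hFper hWc1 hWper hiii hψ hψdiv
  have hweak := fun (ψ : ℝ → EuclideanSpace ℝ (Fin 3) → EuclideanSpace ℝ (Fin 3)) (hψ : IsSpaceTimeTestOn (⊤ : Opens (ℝ × EuclideanSpace ℝ (Fin 3))) ψ)
      (hψdiv : ∀ t, VectorCalculus.IsDivFree (ψ t)) =>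
    veryWeak_of_lineWeakForm (V := mollify η ε U) hG hU2loc' hG2loc hWc1 hdivW hV1 hVm hVb hdivV hdiv hline hψ hψdiv
  ------------------------------------------------------------------
  -- ## the `L^{10/3}` classes and the pressure
  ------------------------------------------------------------------
  have hten := lintegral_period_tenThirds_le (T := T) (C := Cb) hUm hG (ae_of_all _ hUE) hGb
  have hb1 : ((Cb : ℝ≥0∞) ^ (2 / 3 : ℝ) * ((SNormLESNormFDerivOfEqConst (EuclideanSpace ℝ (Fin 3)) (volume : Measure (EuclideanSpace ℝ (Fin 3))) 2 : ℝ≥0∞) ^ 2 * Cb)) ≠ ⊤ :=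
    ENNReal.mul_ne_top (ENNReal.rpow_ne_top_of_nonneg (by norm_num) ENNReal.coe_ne_top)
      (ENNReal.mul_ne_top (ENNReal.pow_ne_top ENNReal.coe_ne_top) ENNReal.coe_ne_top)
  have hU103 : ∀ a b : ℝ, MemLp (uncurry U) (10 / 3) (volume.restrict (Icc a b ×ˢ (univ : Set (EuclideanSpace ℝ (Fin 3))))) :=
    memLp_slab_tenThirds hT hUm hUper (ne_top_of_le_ne_top hb1 hten)
  have hW103 : ∀ a b : ℝ, MemLp (uncurry W) (10 / 3) (volume.restrict (Icc a b ×ˢ (univ : Set (EuclideanSpace ℝ (Fin 3))))) :=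
    memLp_slab_profile hWr
  have hV103 : ∀ a b : ℝ, MemLp (uncurry (mollify η ε U)) (10 / 3) (volume.restrict (Icc a b ×ˢ (univ : Set (EuclideanSpace ℝ (Fin 3))))) :=
    memLp_slab_mollify hη hε hUm one_le_ten_thirds ten_thirds_ne_top hU103
  obtain ⟨p, hpper, hpm, hp53, hpli, hps, hpbound⟩ := hRP hT hUm hWm hVm hUper hWper hVper hU103 hW103 hV103
  ------------------------------------------------------------------
  -- ## the distributional formulation
  ------------------------------------------------------------------
  obtain ⟨hW4, -⟩ : (⨆ s, eLpNorm (W s) 4 volume) < ∞ ∧ True := ⟨hWr.memL4, trivial⟩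
  have hdist := fun (ψ : ℝ → EuclideanSpace ℝ (Fin 3) → EuclideanSpace ℝ (Fin 3)) (hψ : IsSpaceTimeTestOn (⊤ : Opens (ℝ × EuclideanSpace ℝ (Fin 3))) ψ) =>
    distributional_of_veryWeak_slices (V := mollify η ε U) (q := 4) (qp := 5 / 3)
      (CU := (Cb : ℝ≥0∞)) (CV := (∫⁻ y, ‖η y‖ₑ) ^ (2 : ℝ) * (Cb : ℝ≥0∞)) (CW := ⨆ s, eLpNorm (W s) 4 volume)
      hUm ENNReal.coe_ne_top hUE hVm hCV hVE hWc1 hdivW (by norm_num) ENNReal.ofNat_ne_top hW4.ne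
      (fun s => le_iSup (fun s => eLpNorm (W s) 4 volume) s) hdiv
      (by rw [ENNReal.le_div_iff_mul_le (Or.inl (by norm_num)) (Or.inl (by norm_num))]; norm_num)
      (ENNReal.div_ne_top (by norm_num) (by norm_num)) hp53 hps hweak hψ
  ------------------------------------------------------------------
  -- ## the Stokes form and the local energy balance
  ------------------------------------------------------------------
  have hStokes := stokesForm_of_distributional (V := mollify η ε U) hG hU2loc' hG2loc hWc1 hdivW hV1 hVm hVb hdivV hdiv hpli hdist
  have hpq : ∀ K : Set (ℝ × EuclideanSpace ℝ (Fin 3)), IsCompact K → MemLp (uncurry p) (5 / 3) (volume.restrict K) := by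
    intro K hK
    obtain ⟨a, b, hKab⟩ := exists_subset_Icc_prod_univ_of_isCompact hK
    have h := (hp53 a b).restrict K
    rwa [Measure.restrict_restrict hK.measurableSet, inter_eq_left.2 hKab] at h
  have hUq : ∀ K : Set (ℝ × EuclideanSpace ℝ (Fin 3)), IsCompact K → MemLp (uncurry U) (5 / 2) (volume.restrict K) := by
    intro K hK
    obtain ⟨a, b, hKab⟩ := exists_subset_Icc_prod_univ_of_isCompact hK
    haveI : IsFiniteMeasure (volume.restrict K) := isFiniteMeasure_restrict.2 hK.measure_lt_top.ne
    have h := (hU103 a b).restrict K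
    rw [Measure.restrict_restrict hK.measurableSet, inter_eq_left.2 hKab] at h
    refine h.mono_exponent ?_
    have e1 : (5 / 2 : ℝ≥0∞) = ENNReal.ofReal (5 / 2) := by
      rw [ENNReal.ofReal_div_of_pos (by norm_num)]; simp
    have e2 : (10 / 3 : ℝ≥0∞) = ENNReal.ofReal (10 / 3) := by
      rw [ENNReal.ofReal_div_of_pos (by norm_num)]; simp
    rw [e1, e2]
    exact ENNReal.ofReal_le_ofReal (by norm_num)
  have hlei := fun (ψ : ℝ → EuclideanSpace ℝ (Fin 3) → ℝ) (hψ : IsSpaceTimeTestOn (⊤ : Opens (ℝ × EuclideanSpace ℝ (Fin 3))) ψ) =>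
    local_energy_balance_iterated (V := mollify η ε U) hWc1 hdivW hV1 hVm hVb hdivV hG hU2loc' hG2loc hpq hUq hStokes hψ
  ------------------------------------------------------------------
  -- ## the bounds
  ------------------------------------------------------------------
  have hCx1' : ∀ s, ∫⁻ y, ‖U s y‖ₑ ^ 2 ≤ (Cx : ℝ≥0∞) := fun s => (hUE s).trans hCx1
  have hGb' : ∫⁻ z in Ioo 0 T ×ˢ (univ : Set (EuclideanSpace ℝ (Fin 3))), ENNReal.ofReal (frobeniusNormSq (G z.1 z.2)) ≤ (Cx : ℝ≥0∞) :=
    hGb.trans hCx1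
  have hpress : ∫⁻ z in Ioo 0 T ×ˢ (univ : Set (EuclideanSpace ℝ (Fin 3))), ‖p z.1 z.2‖ₑ ^ (5 / 3 : ℝ) ≤ (Cx : ℝ≥0∞) := by
    refine hpbound.trans (le_trans (mul_le_mul' le_rfl ?_) hCx2)
    refine add_le_add (add_le_add hten ?_) ?_
    · have h := lintegral_slab_profile_le hWr (Ioo 0 T)
      rwa [Real.volume_Ioo, sub_zero] at h
    · exact (lintegral_slab_mollify_rpow_le hη hε hUm (Ioo 0 T) (q := 10 / 3) (by norm_num)).trans
        (mul_le_mul' le_rfl hten)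
  ------------------------------------------------------------------
  -- ## the assembly
  ------------------------------------------------------------------
  refine ⟨p, ⟨hUper, hpper, hdiv, hCx1', hpli, hpress, fun ψ hψ => hdist ψ hψ, ?_⟩⟩
  exact ⟨G, hG, hGb', hiii, fun ψ hψ _ => hlei ψ hψ⟩

end Packaging

/-! ### The Galerkin limit: a periodic field with the bounds and the weak formulation -/

section GalerkinLimitData

set_option maxHeartbeats 6400000 in
/-- **The Galerkin limit `k → ∞` of [BT1] Lemma 2.6 / proof of Thm 2.4 at fixed `ε`**: from the
periodic solutions of the Galerkin systems with the uniform bound `C` (Lemma 2.6) over the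
Galerkin spaces of a `C¹`-dense family of `𝒱`, a subsequence converges (strongly in `L²_loc`,
gradients weakly in `L²` of slabs) to a `T`-periodic, jointly measurable `U` with measurable
slices of energy `≤ C` for every `s`, a `T`-periodic weak spatial gradient `G` with
`∫∫_{(0,T)×ℝ³} |G|² ≤ 2(⌈(2⌈T⌉₊+2)/T⌉₊+1) C`, a.e. weakly divergence-free slices, and the weak
formulation (iii) of the mollified perturbed Leray system against every `f ∈ 𝒟_T`
(`exists_galerkin_velocity_limit`, `exists_gradient_limit`, the periodic representatives,
`intervalIntegral_galerkin_identity`, `periodWeakForm_of_limit`, `exists_galerkin_test_approx_uniform`,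
`periodWeakForm_of_approx`). [cite: BradshawTsai2017AHP, proof of Thm 2.4 (limit k → ∞); Temam1979, Ch. III §3] -/
theorem exists_galerkin_limit_data {T : ℝ} (hT : 0 < T) {α : ℝ} {W : ℝ → EuclideanSpace ℝ (Fin 3) → EuclideanSpace ℝ (Fin 3)}
    (hWr : IsRevisedProfile T (10 / 3) α W) {η : EuclideanSpace ℝ (Fin 3) → ℝ} (hη : IsMollifyingKernel η) {ε : ℝ} (hε : 0 < ε)
    {C : ℝ≥0}
    (h26 : ∀ {k : ℕ} {a : Fin k → EuclideanSpace ℝ (Fin 3) → EuclideanSpace ℝ (Fin 3)},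
      (∀ i, FunctionSpaces.IsTestFunctionOn (⊤ : Opens (EuclideanSpace ℝ (Fin 3))) (a i)) →
      (∀ i, VectorCalculus.IsDivFree (a i)) →
      (∀ i j, ∫ y, ⟪a i y, a j y⟫ = if i = j then (1 : ℝ) else 0) →
      ∃ b : ℝ → EuclideanSpace ℝ (Fin k),
        (∀ s, HasDerivAt b (galerkinRHS W (BradshawTsai2019.scaledMollifier η ε) a s (b s)) s) ∧
        (∀ s, b (s + T) = b s) ∧
        (∀ s, ∫ y, ‖galerkinSum a (b s) y‖ ^ 2 ≤ C) ∧
        ∫ s in (0 : ℝ)..T, (∫ y, frobeniusNormSq (fderiv ℝ (galerkinSum a (b s)) y)) ≤ C) :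
    ∃ (U : ℝ → EuclideanSpace ℝ (Fin 3) → EuclideanSpace ℝ (Fin 3)) (G : ℝ → EuclideanSpace ℝ (Fin 3) → EuclideanSpace ℝ (Fin 3) →L[ℝ] EuclideanSpace ℝ (Fin 3)),
      AEStronglyMeasurable (uncurry U) volume ∧
      (∀ s, AEStronglyMeasurable (U s) (volume : Measure (EuclideanSpace ℝ (Fin 3)))) ∧
      (∀ s y, U (s + T) y = U s y) ∧ (∀ s y, G (s + T) y = G s y) ∧
      (∀ s, ∫⁻ y, ‖U s y‖ₑ ^ 2 ≤ C) ∧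
      HasWeakSpatialGradientOn (⊤ : Opens (ℝ × EuclideanSpace ℝ (Fin 3))) U G ∧
      (∫⁻ z in Ioo 0 T ×ˢ (univ : Set (EuclideanSpace ℝ (Fin 3))), ENNReal.ofReal (frobeniusNormSq (G z.1 z.2)) ≤
        2 * (⌈(((⌈T⌉₊ : ℝ) + 1) - (-((⌈T⌉₊ : ℝ) + 1))) / T⌉₊ + 1 : ℕ) * C) ∧
      (∀ᵐ s : ℝ, IsWeaklyDivFree (U s)) ∧
      (∀ f : ℝ → EuclideanSpace ℝ (Fin 3) → EuclideanSpace ℝ (Fin 3), IsPeriodicDivFreeTest T f →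
        ∫ s in Ioo 0 T, ((∫ y, (⟪U s y, timeDeriv f s y⟫ -
            frobeniusInner (G s y) (fderiv ℝ (f s) y) +
            ⟪U s y + G s y y - G s y (W s y + mollify η ε U s y) -
              fderiv ℝ (W s) y (U s y) - fderiv ℝ (W s) y (W s y), f s y⟫)) -
          lerayPairing W s (f s)) = 0) := by
  have happ : Continuous (uncurry fun (L : EuclideanSpace ℝ (Fin 3) →L[ℝ] EuclideanSpace ℝ (Fin 3)) (v : EuclideanSpace ℝ (Fin 3)) => L v) :=
    isBoundedBilinearMap_apply.continuous
  have hWc1 : ContDiff ℝ 1 (uncurry W) := hWr.contDiff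
  have hWper : ∀ s y, W (s + T) y = W s y := hWr.periodic
  have hdivW : ∀ s, VectorCalculus.IsDivFree (W s) := hWr.divFree
  set ρ : EuclideanSpace ℝ (Fin 3) → ℝ := BradshawTsai2019.scaledMollifier η ε with hρdef
  have hρ : Continuous ρ := (contDiff_scaledMollifier hη ε).continuous
  have hρc : HasCompactSupport ρ := hasCompactSupport_scaledMollifier' hη hε
  obtain ⟨cℓ, hcℓ⟩ := hWr.leray_dual
  have hℓ : ∀ g : EuclideanSpace ℝ (Fin 3) → EuclideanSpace ℝ (Fin 3), FunctionSpaces.IsTestFunctionOn (⊤ : Opens (EuclideanSpace ℝ (Fin 3))) g →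
      ∃ Cℓ : ℝ, ∀ s, |lerayPairing W s g| ≤ Cℓ := fun g hg => ⟨cℓ * h1Norm g, fun s => hcℓ s g hg⟩
  ------------------------------------------------------------------
  -- ## Step 0: the Galerkin data
  ------------------------------------------------------------------
  obtain ⟨σ, hσ, hσd⟩ := exists_countable_dense_testDivFree
  choose kk a haG hat hadiv hon hspan using fun m => exists_orthonormal_family_galerkinSpace hσ m
  have haV : ∀ m i, a m i ∈ testDivFreeSubmodule := fun m i => galerkinSpace_le hσ m (haG m i)
  have hgal : ∀ m, ∀ g ∈ galerkinSpace σ m, ∃ c : EuclideanSpace ℝ (Fin (kk m)), galerkinSum (a m) c = g := by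
    intro m g hg
    obtain ⟨c, hc⟩ := hspan m g hg
    refine ⟨WithLp.toLp 2 c, ?_⟩
    rw [hc]
    funext y
    simp only [galerkinSum_apply]
  choose b hb hbT hbE hbD using fun m => h26 (hat m) (hadiv m) (hon m)
  have hC0 : 0 ≤ (C : ℝ) := C.2
  have hbn : ∀ m s, ‖b m s‖ ^ 2 ≤ C := fun m s => by
    rw [← integral_norm_sq_galerkinSum (fun i => (hat m i).contDiff.continuous)
      (fun i => (hat m i).hasCompactSupport) (hon m)]
    exact hbE m s
  have hbc : ∀ m, Continuous (b m) := fun m => continuous_iff_continuousAt.2 fun s => (hb m s).continuousAt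
  -- the approximants and their gradients
  set U : ℕ → ℝ → EuclideanSpace ℝ (Fin 3) → EuclideanSpace ℝ (Fin 3) := fun k s y => galerkinSum (a k) (b k s) y with hUdef
  set G : ℕ → ℝ → EuclideanSpace ℝ (Fin 3) → EuclideanSpace ℝ (Fin 3) →L[ℝ] EuclideanSpace ℝ (Fin 3) := fun k s y => fderiv ℝ (galerkinSum (a k) (b k s)) y with hGdef
  have hUm : ∀ k, AEStronglyMeasurable (uncurry (U k)) (volume : Measure (ℝ × EuclideanSpace ℝ (Fin 3))) := fun k =>
    (continuous_uncurry_galerkinSum (hat k) (hbc k)).aestronglyMeasurable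
  have hUs : ∀ k s, AEStronglyMeasurable (U k s) (volume : Measure (EuclideanSpace ℝ (Fin 3))) := fun k s =>
    (isTestFunctionOn_galerkinSum (hat k) (b k s)).contDiff.continuous.aestronglyMeasurable
  have hUE : ∀ k s, ∫⁻ y, ‖U k s y‖ₑ ^ 2 ≤ (C : ℝ≥0∞) := fun k s => by
    have h := lintegral_enorm_sq_galerkinSum_le (hat k) (hon k) (hbn k s)
    rwa [ENNReal.ofReal_coe_nnreal] at h
  have hGg : ∀ k, HasWeakSpatialGradientOn (⊤ : Opens (ℝ × EuclideanSpace ℝ (Fin 3))) (U k) (G k) := fun k =>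
    hasWeakSpatialGradientOn_galerkinSum (hat k) (hbc k)
  have hGb : ∀ k, ∫⁻ z in Ioo 0 T ×ˢ (univ : Set (EuclideanSpace ℝ (Fin 3))), ENNReal.ofReal (frobeniusNormSq (G k z.1 z.2)) ≤ (C : ℝ≥0∞) := by
    intro k
    have h := lintegral_period_frobenius_galerkinSum_le hT (hat k) (hbc k) (hbD k)
    rwa [ENNReal.ofReal_coe_nnreal] at h
  have hper : ∀ k s y, U k (s + T) y = U k s y := fun k s y => by
    simp only [hUdef, hbT k s]
  have hUdivk : ∀ k s, IsWeaklyDivFree (U k s) := fun k s =>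
    VectorCalculus.IsDivFree.isWeaklyDivFree_holds
      (isDivFree_galerkinSum (fun i => ((hat k i).contDiff.of_le (by exact_mod_cast le_top) : ContDiff ℝ 1 (a k i)).differentiable
        one_ne_zero) (hadiv k) (b k s))
      ((isTestFunctionOn_galerkinSum (hat k) (b k s)).contDiff.of_le (by exact_mod_cast le_top))
  -- `L²` on cylinders
  have hUslab : ∀ k (a' b' : ℝ), MemLp (uncurry (U k)) 2 (volume.restrict (Icc a' b' ×ˢ (univ : Set (EuclideanSpace ℝ (Fin 3))))) :=
    fun k => memLp_slab_of_forall_lintegral_le (hUm k) two_ne_zero ENNReal.ofNat_ne_top ENNReal.coe_ne_top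
      (fun s => by rw [ENNReal.toReal_ofNat]; exact_mod_cast hUE k s)
  have hU2Q : ∀ k (n : ℕ), ∫⁻ z in Ioo (-((n : ℝ) + 1)) ((n : ℝ) + 1) ×ˢ ball (0 : EuclideanSpace ℝ (Fin 3)) (n + 1), ‖U k z.1 z.2‖ₑ ^ 2 < ∞ := by
    intro k n
    have h := (hUslab k (-((n : ℝ) + 1)) ((n : ℝ) + 1)).2
    rw [FunctionSpaces.AubinLions.eLpNorm_two_eq_rpow] at h
    have h' := (ENNReal.rpow_lt_top_iff_of_pos (by norm_num : (0:ℝ) < 1 / 2)).1 h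
    exact lt_of_le_of_lt (lintegral_mono_set (prod_mono Ioo_subset_Icc_self (subset_univ _))) h'
  ------------------------------------------------------------------
  -- ## Step 1: extraction of the limits along one subsequence
  ------------------------------------------------------------------
  obtain ⟨φ, Ul0, hφ, hφmono, hUl0m, hslice0, hconv2φ, -⟩ :=
    exists_galerkin_velocity_limit (ρ := ρ) (σ := σ) (kk := kk) (a := a) (b := b) hT hWc1 hWper hℓ hρ hρc hσ hσd haV hon
      hgal hb hbT hC0 hC0 hbn hbD
  obtain ⟨κ, Gu, hκ, hGu0, hGub0, hGwκ⟩ := exists_gradient_limit (C := C) hT (U := fun k => U (φ k)) (G := fun k => G (φ k))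
    (fun k => hper (φ k)) (fun k => hGg (φ k)) (fun k => hGb (φ k)) (fun k => hU2Q (φ k)) (φ := id) (u := Ul0) hUl0m
    (fun n => by simpa using hconv2φ n)
  set τ : ℕ → ℕ := fun k => φ (κ k) with hτ
  have hτm : StrictMono τ := hφ.comp hκ
  have hτid : ∀ k, k ≤ τ k := fun k => hτm.id_le k
  have hconv2τ : ∀ n : ℕ, Tendsto (fun k => ∫⁻ z in Ioo (-((n : ℝ) + 1)) ((n : ℝ) + 1) ×ˢ ball (0 : EuclideanSpace ℝ (Fin 3)) (n + 1), ‖U (τ k) z.1 z.2 - Ul0 z.1 z.2‖ₑ ^ 2) atTop (𝓝 0) :=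
    fun n => (hconv2φ n).comp hκ.tendsto_atTop
  ------------------------------------------------------------------
  -- ## Step 2: a.e. periodicity and the periodic representative of the velocity
  ------------------------------------------------------------------
  have hUper : ∀ k : ℤ, ∀ᵐ z : ℝ × EuclideanSpace ℝ (Fin 3), Ul0 (z.1 + k * T) z.2 = Ul0 z.1 z.2 := by
    intro k
    refine ae_comp_timeShift_eq_of_limit (U := fun j => U (φ j)) (fun j => hUm _) (fun j s y => ?_) hUl0m hconv2φ
    have hp : Function.Periodic (fun s => U (φ j) s y) T := fun s => hper (φ j) s y
    exact hp.int_mul k s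
  set Ulp : ℝ → EuclideanSpace ℝ (Fin 3) → EuclideanSpace ℝ (Fin 3) := fun s y => Ul0 (Int.fract (s / T) * T) y with hUlp
  have hUlp_ae : ∀ᵐ z : ℝ × EuclideanSpace ℝ (Fin 3), Ulp z.1 z.2 = Ul0 z.1 z.2 := ae_periodize_eq hT hUper
  have hUlp_per : ∀ s y, Ulp (s + T) y = Ulp s y := fun s y => periodize_add hT.ne' Ul0 s y
  set GoodT : Set ℝ := {s | AEStronglyMeasurable (Ulp s) (volume : Measure (EuclideanSpace ℝ (Fin 3))) ∧
    ∫⁻ y, ‖Ulp s y‖ₑ ^ 2 ≤ C} with hGoodT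
  set Uf : ℝ → EuclideanSpace ℝ (Fin 3) → EuclideanSpace ℝ (Fin 3) := GoodT.indicator Ulp with hUf
  have hGoodT_per : ∀ s, s + T ∈ GoodT ↔ s ∈ GoodT := by
    intro s
    have e : Ulp (s + T) = Ulp s := funext (hUlp_per s)
    simp only [hGoodT, mem_setOf_eq, e]
  have hUf_per : ∀ s y, Uf (s + T) y = Uf s y := by
    intro s y
    rw [hUf]
    by_cases hs : s ∈ GoodT
    · rw [indicator_of_mem ((hGoodT_per s).2 hs), indicator_of_mem hs, hUlp_per]
    · rw [indicator_of_notMem (fun h => hs ((hGoodT_per s).1 h)), indicator_of_notMem hs]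
  have hUf_good : ∀ s ∈ GoodT, Uf s = Ulp s := fun s hs => by rw [hUf, indicator_of_mem hs]
  have hUf_bad : ∀ s, s ∉ GoodT → Uf s = 0 := fun s hs => by rw [hUf, indicator_of_notMem hs]
  have hslice_Ul0 : ∀ᵐ s : ℝ, ∫⁻ y, ‖Ul0 s y‖ₑ ^ 2 ≤ C := ae_lintegral_sq_le_of_forall_ball
    (fun n => by simpa [ENNReal.ofReal_coe_nnreal] using hslice0 n)
  have hgood_ae : ∀ᵐ s : ℝ, s ∈ GoodT := by
    have h1 : ∀ᵐ s : ℝ, ∀ᵐ y : EuclideanSpace ℝ (Fin 3), Ulp s y = Ul0 s y := by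
      have h := hUlp_ae
      rw [Measure.volume_eq_prod] at h
      exact Measure.ae_ae_of_ae_prod h
    have h2 : ∀ᵐ s : ℝ, AEStronglyMeasurable (Ul0 s) (volume : Measure (EuclideanSpace ℝ (Fin 3))) := by
      have h := hUl0m
      rw [Measure.volume_eq_prod] at h
      exact h.prodMk_left
    filter_upwards [h1, h2, hslice_Ul0] with s hs1 hs2 hs3
    have hae : Ulp s =ᵐ[volume] Ul0 s := hs1
    refine ⟨hs2.congr hae.symm, ?_⟩
    rw [lintegral_congr_ae (hae.mono fun y hy => by rw [hy])]
    exact hs3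
  have hUf_ae : ∀ᵐ z : ℝ × EuclideanSpace ℝ (Fin 3), Uf z.1 z.2 = Ul0 z.1 z.2 := by
    have h1 : ∀ᵐ z : ℝ × EuclideanSpace ℝ (Fin 3), z.1 ∈ GoodT := by
      have h := (Measure.quasiMeasurePreserving_fst (μ := (volume : Measure ℝ))
        (ν := (volume : Measure (EuclideanSpace ℝ (Fin 3))))).ae hgood_ae
      rw [← Measure.volume_eq_prod] at h
      exact h
    filter_upwards [h1, hUlp_ae] with z hz1 hz2
    rw [hUf_good z.1 hz1]
    exact hz2
  have hUfm : AEStronglyMeasurable (uncurry Uf) (volume : Measure (ℝ × EuclideanSpace ℝ (Fin 3))) :=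
    hUl0m.congr (hUf_ae.mono fun z hz => by simp only [uncurry]; exact hz.symm)
  have hUf_energy : ∀ s, ∫⁻ y, ‖Uf s y‖ₑ ^ 2 ≤ C := by
    intro s
    by_cases hs : s ∈ GoodT
    · rw [hUf_good s hs]; exact hs.2
    · rw [hUf_bad s hs]; simp
  have hUf_sm : ∀ s, AEStronglyMeasurable (Uf s) (volume : Measure (EuclideanSpace ℝ (Fin 3))) := by
    intro s
    by_cases hs : s ∈ GoodT
    · rw [hUf_good s hs]; exact hs.1
    · rw [hUf_bad s hs]; exact aestronglyMeasurable_const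
  -- the transferred convergences and the weak gradient of `Uf`
  have hsq_ae : ∀ k, (fun z : ℝ × EuclideanSpace ℝ (Fin 3) => ‖U (τ k) z.1 z.2 - Uf z.1 z.2‖ₑ ^ 2) =ᵐ[volume]
      fun z => ‖U (τ k) z.1 z.2 - Ul0 z.1 z.2‖ₑ ^ 2 := fun k => hUf_ae.mono fun z hz => by
    show ‖U (τ k) z.1 z.2 - Uf z.1 z.2‖ₑ ^ 2 = ‖U (τ k) z.1 z.2 - Ul0 z.1 z.2‖ₑ ^ 2
    rw [hz]
  have hconv2 : ∀ n : ℕ, Tendsto (fun k => ∫⁻ z in Ioo (-((n : ℝ) + 1)) ((n : ℝ) + 1) ×ˢ ball (0 : EuclideanSpace ℝ (Fin 3)) (n + 1), ‖U (τ k) z.1 z.2 - Uf z.1 z.2‖ₑ ^ 2) atTop (𝓝 0) := by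
    intro n
    refine (hconv2τ n).congr fun k => ?_
    exact (lintegral_congr_ae (ae_restrict_of_ae (hsq_ae k))).symm
  have hGuf : HasWeakSpatialGradientOn (⊤ : Opens (ℝ × EuclideanSpace ℝ (Fin 3))) Uf Gu := by
    refine hGu0.congr_ae ?_
    rw [Opens.coe_top, Measure.restrict_univ]
    filter_upwards [hUf_ae] with z hz
    simp only [uncurry]
    exact hz.symm
  ------------------------------------------------------------------
  -- ## Step 3: the periodic representative of the gradient
  ------------------------------------------------------------------
  have hGuper : ∀ k : ℤ, ∀ᵐ z : ℝ × EuclideanSpace ℝ (Fin 3), Gu (z.1 + k * T) z.2 = Gu z.1 z.2 := by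
    have h := hGuf.ae_forall_comp_add_int_mul hUf_per
    intro k
    filter_upwards [h] with z hz using hz k
  set Gup : ℝ → EuclideanSpace ℝ (Fin 3) → EuclideanSpace ℝ (Fin 3) →L[ℝ] EuclideanSpace ℝ (Fin 3) := fun s y => Gu (Int.fract (s / T) * T) y with hGup
  have hGup_ae : ∀ᵐ z : ℝ × EuclideanSpace ℝ (Fin 3), Gup z.1 z.2 = Gu z.1 z.2 := ae_periodize_eq hT hGuper
  have hGup_per : ∀ s y, Gup (s + T) y = Gup s y := fun s y => periodize_add hT.ne' Gu s y
  have hGufp : HasWeakSpatialGradientOn (⊤ : Opens (ℝ × EuclideanSpace ℝ (Fin 3))) Uf Gup := by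
    refine hGuf.congr_grad_ae ?_
    rw [Opens.coe_top, Measure.restrict_univ]
    filter_upwards [hGup_ae] with z hz
    simp only [uncurry]
    exact hz
  have hGupb : ∀ m : ℕ, ∫⁻ z in Ioo (-((m : ℝ) + 1)) ((m : ℝ) + 1) ×ˢ (univ : Set (EuclideanSpace ℝ (Fin 3))), ENNReal.ofReal (frobeniusNormSq (Gup z.1 z.2)) ≤
      2 * (⌈(((m : ℝ) + 1) - (-((m : ℝ) + 1))) / T⌉₊ + 1 : ℕ) * (C : ℝ≥0∞) := by
    intro m
    rw [lintegral_congr_ae (ae_restrict_of_ae (hGup_ae.mono fun z hz => by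
      show ENNReal.ofReal (frobeniusNormSq (Gup z.1 z.2)) = ENNReal.ofReal (frobeniusNormSq (Gu z.1 z.2))
      rw [hz]))]
    exact hGub0 m
  have hGupb' : ∀ m : ℕ, ∫⁻ z in Ioo (-((m : ℝ) + 1)) ((m : ℝ) + 1) ×ˢ (univ : Set (EuclideanSpace ℝ (Fin 3))), ENNReal.ofReal (frobeniusNormSq (Gup z.1 z.2)) < ∞ := fun m =>
    (hGupb m).trans_lt (ENNReal.mul_lt_top (ENNReal.mul_lt_top ENNReal.ofNat_lt_top (ENNReal.natCast_lt_top _)) ENNReal.coe_lt_top)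
  have hGwp : ∀ (m : ℕ) (v : EuclideanSpace ℝ (Fin 3)) (h : ℝ × EuclideanSpace ℝ (Fin 3) → EuclideanSpace ℝ (Fin 3)),
      MemLp h 2 (volume.restrict (Ioo (-((m : ℝ) + 1)) ((m : ℝ) + 1) ×ˢ (univ : Set (EuclideanSpace ℝ (Fin 3))))) →
      Tendsto (fun k => ∫ z in Ioo (-((m : ℝ) + 1)) ((m : ℝ) + 1) ×ˢ (univ : Set (EuclideanSpace ℝ (Fin 3))), ⟪G (τ k) z.1 z.2 v, h z⟫) atTop
        (𝓝 (∫ z in Ioo (-((m : ℝ) + 1)) ((m : ℝ) + 1) ×ˢ (univ : Set (EuclideanSpace ℝ (Fin 3))), ⟪Gup z.1 z.2 v, h z⟫)) := by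
    intro m v h hh
    have e : ∫ z in Ioo (-((m : ℝ) + 1)) ((m : ℝ) + 1) ×ˢ (univ : Set (EuclideanSpace ℝ (Fin 3))), ⟪Gup z.1 z.2 v, h z⟫ = ∫ z in Ioo (-((m : ℝ) + 1)) ((m : ℝ) + 1) ×ˢ (univ : Set (EuclideanSpace ℝ (Fin 3))), ⟪Gu z.1 z.2 v, h z⟫ :=
      integral_congr_ae (ae_restrict_of_ae (hGup_ae.mono fun z hz => by
        show ⟪Gup z.1 z.2 v, h z⟫ = ⟪Gu z.1 z.2 v, h z⟫
        rw [hz]))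
    rw [e]
    exact hGwκ m v h hh
  -- the period bound of the gradient: `(0, T)` lies in the slab `m = ⌈T⌉₊`
  have hGT : ∫⁻ z in Ioo 0 T ×ˢ (univ : Set (EuclideanSpace ℝ (Fin 3))), ENNReal.ofReal (frobeniusNormSq (Gup z.1 z.2)) ≤
      2 * (⌈(((⌈T⌉₊ : ℝ) + 1) - (-((⌈T⌉₊ : ℝ) + 1))) / T⌉₊ + 1 : ℕ) * C := by
    refine (lintegral_mono_set ?_).trans (hGupb ⌈T⌉₊)
    refine prod_mono (fun s hs => ⟨?_, ?_⟩) Subset.rfl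
    · linarith [hs.1, (Nat.cast_nonneg ⌈T⌉₊ : (0 : ℝ) ≤ ⌈T⌉₊)]
    · linarith [hs.2, Nat.le_ceil T]
  ------------------------------------------------------------------
  -- ## Step 4: almost every slice of the limit is weakly divergence free
  ------------------------------------------------------------------
  have hslm : ∀ᵐ s : ℝ, AEStronglyMeasurable (Ul0 s) (volume : Measure (EuclideanSpace ℝ (Fin 3))) := by
    have h := hUl0m
    rw [Measure.volume_eq_prod] at h
    exact h.prodMk_left
  obtain ⟨hUlQ, -⟩ := locallyIntegrable_of_cylinder_limit (V := fun k => U (φ k)) (fun k => hUm _)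
    (fun k n => hU2Q (φ k) n) hUl0m hconv2φ
  have hUl : ∀ᵐ s : ℝ, IsWeaklyDivFree (Ul0 s) := by
    refine ae_isWeaklyDivFree_of_forall_test (μ := volume) (v := Ul0) ?_ ?_
    · filter_upwards [hslm, hslice_Ul0] with s hs h2
      exact ⟨hs, fun n => (setLIntegral_le_lintegral _ _).trans_lt (h2.trans_lt ENNReal.coe_lt_top)⟩
    intro θ hθ
    have hg : FunctionSpaces.IsTestFunctionOn (⊤ : Opens (EuclideanSpace ℝ (Fin 3))) (gradient θ) :=
    ⟨(InnerProductSpace.toDual ℝ (EuclideanSpace ℝ (Fin 3))).symm.contDiff.comp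
      (hθ.contDiff.fderiv_right (m := (⊤ : ℕ∞)) (by exact_mod_cast le_top)),
     (hθ.hasCompactSupport.fderiv (𝕜 := ℝ)).comp_left
      (g := fun L => (InnerProductSpace.toDual ℝ (EuclideanSpace ℝ (Fin 3))).symm L) (by simp), by simp⟩
    have hgc : Continuous (gradient θ) := hg.contDiff.continuous
    obtain ⟨Cg, hCg⟩ := hgc.norm.bddAbove_range_of_hasCompactSupport hg.hasCompactSupport.norm
    have hCg' : ∀ x, ‖gradient θ x‖ ≤ Cg := fun x => hCg ⟨x, rfl⟩
    have hCg0 : 0 ≤ Cg := (norm_nonneg _).trans (hCg' 0)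
    obtain ⟨r, hr⟩ := hg.hasCompactSupport.isCompact.isBounded.subset_closedBall (0 : EuclideanSpace ℝ (Fin 3))
    set n₀ : ℕ := ⌈|r|⌉₊ with hn₀
    have hwin : ∀ n : ℕ, n₀ ≤ n → ∀ᵐ t : ℝ, t ∈ Ioo (-((n : ℝ) + 1)) ((n : ℝ) + 1) →
        ∫ x, ⟪Ul0 t x, gradient θ x⟫ = 0 := by
      intro n hn
      set I : Set ℝ := Ioo (-((n : ℝ) + 1)) ((n : ℝ) + 1) with hI
      set B : Set (EuclideanSpace ℝ (Fin 3)) := ball (0 : EuclideanSpace ℝ (Fin 3)) (n + 1) with hB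
      have hsuppB : tsupport (gradient θ) ⊆ B := by
        refine hr.trans (closedBall_subset_ball ?_)
        calc r ≤ |r| := le_abs_self r
          _ ≤ n₀ := Nat.le_ceil _
          _ ≤ n := by exact_mod_cast hn
          _ < n + 1 := lt_add_one _
      have hfin : ∀ k, ∫⁻ z in I ×ˢ B, ‖uncurry (U (φ k)) z - uncurry Ul0 z‖ₑ ^ 2 ≠ ⊤ := by
        intro k
        refine ((setLIntegral_enorm_sub_sq_le (hUm (φ k)) _).trans_lt ?_).ne
        refine ENNReal.mul_lt_top ENNReal.ofNat_lt_top (ENNReal.add_lt_top.2 ⟨hU2Q (φ k) n, hUlQ n⟩)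
      obtain ⟨σ', -, hae⟩ := FunctionSpaces.AubinLions.exists_subseq_ae_tendsto_slice (I := I) (O := B)
        (f := fun k => uncurry (U (φ k))) (g := uncurry Ul0) (fun k => (hUm (φ k)).restrict) hUl0m.restrict hfin (hconv2φ n)
      rw [ae_restrict_iff' measurableSet_Ioo] at hae
      filter_upwards [hae, hslm, hslice_Ul0] with t ht hts h2 htI
      have hlim := ht htI
      haveI : IsFiniteMeasure ((volume : Measure (EuclideanSpace ℝ (Fin 3))).restrict B) :=
        ⟨by rw [Measure.restrict_apply_univ]; exact measure_ball_lt_top⟩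
      have hUk2 : ∀ j, MemLp (U (φ (σ' j)) t) 2 ((volume : Measure (EuclideanSpace ℝ (Fin 3))).restrict B) := fun j =>
        (MemLp.restrict B ⟨hUs _ t, (FunctionSpaces.AubinLions.eLpNorm_two_eq_rpow (U (φ (σ' j)) t) volume).symm ▸
          ENNReal.rpow_lt_top_of_nonneg (by norm_num) ((hUE _ t).trans_lt ENNReal.coe_lt_top).ne⟩)
      have hUlt2 : MemLp (Ul0 t) 2 ((volume : Measure (EuclideanSpace ℝ (Fin 3))).restrict B) :=
        MemLp.restrict B ⟨hts, (FunctionSpaces.AubinLions.eLpNorm_two_eq_rpow (Ul0 t) volume).symm ▸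
          ENNReal.rpow_lt_top_of_nonneg (by norm_num) (h2.trans_lt ENNReal.coe_lt_top).ne⟩
      have hconvB : Tendsto (fun j => eLpNorm (U (φ (σ' j)) t - Ul0 t) 2 ((volume : Measure (EuclideanSpace ℝ (Fin 3))).restrict B))
          atTop (𝓝 0) :=
        FunctionSpaces.tendsto_eLpNorm_two_of_tendsto_lintegral_sq (f := fun j => U (φ (σ' j)) t) (g := Ul0 t) hlim
      have hpair := tendsto_integral_inner_of_tendsto_eLpNorm_two_bdd hUk2 hUlt2 hconvB
        hgc.aestronglyMeasurable hCg0 hCg'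
      have hvan : ∀ (v : EuclideanSpace ℝ (Fin 3) → EuclideanSpace ℝ (Fin 3)) (x : EuclideanSpace ℝ (Fin 3)), x ∉ B →
          ⟪v x, gradient θ x⟫ = 0 := fun v x hx => by
        rw [image_eq_zero_of_notMem_tsupport (fun h => hx (hsuppB h)), inner_zero_right]
      simp only [setIntegral_eq_integral_of_forall_compl_eq_zero (hvan _)] at hpair
      have h0 : (fun j => ∫ x, ⟪U (φ (σ' j)) t x, gradient θ x⟫) = fun _ => 0 :=
        funext fun j => hUdivk (φ (σ' j)) t θ hθ
      rw [h0] at hpair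
      exact (tendsto_nhds_unique tendsto_const_nhds hpair).symm
    have hall : ∀ᵐ t : ℝ, ∀ n : ℕ, n₀ ≤ n → t ∈ Ioo (-((n : ℝ) + 1)) ((n : ℝ) + 1) → ∫ x, ⟪Ul0 t x, gradient θ x⟫ = 0 := by
      rw [ae_all_iff]
      intro n
      by_cases hn : n₀ ≤ n
      · filter_upwards [hwin n hn] with t ht _ using ht
      · exact Eventually.of_forall fun t h => absurd h hn
    filter_upwards [hall] with t ht
    set n : ℕ := max n₀ ⌈|t|⌉₊ with hn
    refine ht n (le_max_left _ _) ?_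
    have h1 : |t| ≤ n := (Nat.le_ceil |t|).trans (by exact_mod_cast le_max_right n₀ ⌈|t|⌉₊)
    constructor <;> [linarith [neg_abs_le t]; linarith [le_abs_self t]]
  have hUfdiv : ∀ᵐ s : ℝ, IsWeaklyDivFree (Uf s) := by
    have h1 : ∀ᵐ s : ℝ, ∀ᵐ y : EuclideanSpace ℝ (Fin 3), Uf s y = Ul0 s y := by
      have h := hUf_ae
      rw [Measure.volume_eq_prod] at h
      exact Measure.ae_ae_of_ae_prod h
    filter_upwards [hUl, h1] with s hs hae θ hθ
    rw [integral_congr_ae ((hae : Uf s =ᵐ[volume] Ul0 s).mono fun y hy => by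
      show ⟪Uf s y, gradient θ y⟫ = ⟪Ul0 s y, gradient θ y⟫
      rw [hy])]
    exact hs θ hθ
  ------------------------------------------------------------------
  -- ## Step 5: the weak formulation of the limit against `𝒟_T`
  ------------------------------------------------------------------
  have hUf_ballE : ∀ n : ℕ, ∀ᵐ t ∂(volume.restrict (Ioo (-((n : ℝ) + 1)) ((n : ℝ) + 1))),
      ∫⁻ x in ball (0 : EuclideanSpace ℝ (Fin 3)) (n + 1), ‖Uf t x‖ₑ ^ 2 ≤ (C : ℝ≥0∞) := fun n =>
    ae_of_all _ fun t => (setLIntegral_le_lintegral _ _).trans (hUf_energy t)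
  have hUfQ : ∀ n : ℕ, ∫⁻ z in Ioo (-((n : ℝ) + 1)) ((n : ℝ) + 1) ×ˢ ball (0 : EuclideanSpace ℝ (Fin 3)) (n + 1), ‖Uf z.1 z.2‖ₑ ^ 2 < ∞ := by
    intro n
    rw [lintegral_congr_ae (ae_restrict_of_ae (hUf_ae.mono fun z hz => by
      show ‖Uf z.1 z.2‖ₑ ^ 2 = ‖Ul0 z.1 z.2‖ₑ ^ 2
      rw [hz]))]
    exact hUlQ n
  -- the identity for the approximants against tests valued in the Galerkin spaces
  have hidk : ∀ {m : ℕ} {g : ℝ → EuclideanSpace ℝ (Fin 3) → EuclideanSpace ℝ (Fin 3)}, IsPeriodicDivFreeTest T g →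
      (∀ s, g s ∈ galerkinSpace σ m) → ∀ {R : ℝ}, (∀ s y, R ≤ ‖y‖ → g s y = 0) →
      ∀ k, m ≤ k → ∫ s in Ioo 0 T, ((∫ y, (⟪U k s y, timeDeriv g s y⟫ -
            frobeniusInner (G k s y) (fderiv ℝ (g s) y) +
            ⟪U k s y + G k s y y - G k s y (W s y + mollify η ε (U k) s y) -
              fderiv ℝ (W s) y (U k s y) - fderiv ℝ (W s) y (W s y), g s y⟫)) -
          lerayPairing W s (g s)) = 0 := by
    intro m g hg hgV R hgR k hk
    have hgV' : ∀ s, ∃ c : EuclideanSpace ℝ (Fin (kk k)), galerkinSum (a k) c = g s := fun s =>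
      hgal k (g s) (galerkinSpace_mono σ hk (hgV s))
    have hGI := intervalIntegral_galerkin_identity (ρ := ρ) hT hWc1 hWper hρ hρc (hat k) (hon k) (hb k) (hbT k)
      hg.contDiff hg.periodic hgR hgV'
    -- the slices
    have hgs : ∀ s, FunctionSpaces.IsTestFunctionOn (⊤ : Opens (EuclideanSpace ℝ (Fin 3))) (g s) := by
      intro s
      obtain ⟨c, hc⟩ := hgV' s
      rw [← hc]
      exact isTestFunctionOn_galerkinSum (hat k) c
    have hg1 : ContDiff ℝ 1 (uncurry g) := hg.contDiff.of_le (by exact_mod_cast le_top)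
    have cgt : Continuous fun z : ℝ × EuclideanSpace ℝ (Fin 3) => timeDeriv g z.1 z.2 := continuous_timeDeriv_of_contDiff_one hg1
    have hpt : ∀ s, (∫ y, (⟪U k s y, timeDeriv g s y⟫ - frobeniusInner (G k s y) (fderiv ℝ (g s) y) +
        ⟪U k s y + G k s y y - G k s y (W s y + mollify η ε (U k) s y) -
          fderiv ℝ (W s) y (U k s y) - fderiv ℝ (W s) y (W s y), g s y⟫)) - lerayPairing W s (g s) =
        (∫ y, ⟪galerkinSum (a k) (b k s) y, timeDeriv g s y⟫) +
          galerkinForm W ρ s (galerkinSum (a k) (b k s)) (g s) := fun s =>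
      clauseIII_integrand_eq_galerkinForm hWc1 hρ hρc (hat k) (b k s) (hgs s) (cgt.comp (Continuous.prodMk_right s)) s
    rw [← integral_Ioc_eq_integral_Ioo, ← intervalIntegral.integral_of_le hT.le]
    rw [intervalIntegral.integral_congr (fun s _ => hpt s)]
    exact hGI
  have hiiif : ∀ f : ℝ → EuclideanSpace ℝ (Fin 3) → EuclideanSpace ℝ (Fin 3), IsPeriodicDivFreeTest T f →
      ∫ s in Ioo 0 T, ((∫ y, (⟪Uf s y, timeDeriv f s y⟫ -
            frobeniusInner (Gup s y) (fderiv ℝ (f s) y) +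
            ⟪Uf s y + Gup s y y - Gup s y (W s y + mollify η ε Uf s y) -
              fderiv ℝ (W s) y (Uf s y) - fderiv ℝ (W s) y (W s y), f s y⟫)) -
          lerayPairing W s (f s)) = 0 := by
    intro f hf
    obtain ⟨R, hfR, happrox⟩ := exists_galerkin_test_approx_uniform hT hσ hσd hf
    set R' : ℝ := max R 1 with hR'
    have hR'0 : 0 < R' := lt_of_lt_of_le one_pos (le_max_right _ _)
    have hfR' : ∀ s y, R' ≤ ‖y‖ → f s y = 0 := fun s y hy => hfR s y ((le_max_left _ _).trans hy)
    refine periodWeakForm_of_approx hT hWc1 hη hε hUfm (ae_of_all _ hUf_energy) hUfQ hGufp hGupb' hf hR'0 hfR' ?_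
    intro δ hδ
    obtain ⟨m, g, hg, hgV, hgR, hfg⟩ := happrox δ hδ
    have hgR' : ∀ s y, R' ≤ ‖y‖ → g s y = 0 := fun s y hy => hgR s y ((le_max_left _ _).trans hy)
    refine ⟨g, hg, hgR', hfg, ?_⟩
    -- clause (iii) for `g`: the limit of the Galerkin identities
    refine periodWeakForm_of_limit (U := fun k => U (τ k)) (G := fun k => G (τ k)) hT hWc1 hη hε
      (fun k => hUm (τ k)) (fun k s => hUs (τ k) s) (fun k s => hUE (τ k) s) (fun k => hGg (τ k))
      (fun k => hGb (τ k)) hUfm hUf_ballE hconv2 hGufp hGupb' hGwp hg ?_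
    filter_upwards [eventually_ge_atTop m] with k hk
    exact hidk hg hgV hgR (τ k) (hk.trans (hτid k))
  exact ⟨Uf, Gup, hUfm, hUf_sm, hUf_per, hGup_per, hUf_energy, hGufp, hGT, hUfdiv, hiiif⟩

end GalerkinLimitData

/-! ### The discharge -/

section Discharge

/-- **[BT1] Theorem 2.4, the mollified periodic Leray solutions with bounds uniform in `ε`**
(discharge of `bradshawTsai2017_thm_2_4_mollified`): for `α₀` of Lemma 2.6, every `T > 0`,
`0 < α ≤ α₀`, every profile with the conclusions of Lemma 2.5 and every mollifying kernel there
is `C` such that for every `ε > 0` the mollified perturbed Leray system has a `T`-periodic weak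
solution `(U, p)` with the a priori bounds `C` (`exists_galerkin_limit_data` +
`exists_pressure_isMollifiedPeriodicWeakSolution`). [cite: BradshawTsai2017AHP, Lemma 2.6 and proof of Thm 2.4 (the limit k → ∞ at fixed ε)] -/
theorem _root_.Literature.Analysis.FluidPDE.bradshawTsai2017_thm_2_4_mollified_holds :
    bradshawTsai2017_thm_2_4_mollified := by
  obtain ⟨α₀, hα₀, hα₀1, h26⟩ := bradshawTsai2017_lemma_2_6
  obtain ⟨Cp, hCp, hP⟩ := exists_pressure_isMollifiedPeriodicWeakSolution
  refine ⟨α₀, hα₀, hα₀1, ?_⟩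
  intro T hT α hα hαle W hWr η hη
  obtain ⟨C, hC⟩ := h26 hT hα hαle hWr hη
  -- the constant: the gradient bound dominates the energy bound
  set Cb : ℝ≥0 := 2 * (⌈(((⌈T⌉₊ : ℝ) + 1) - (-((⌈T⌉₊ : ℝ) + 1))) / T⌉₊ + 1 : ℕ) * C with hCb
  have hCCb : (C : ℝ≥0∞) ≤ Cb := by
    have h1 : (1 : ℝ≥0) ≤ 2 * ((⌈(((⌈T⌉₊ : ℝ) + 1) - (-((⌈T⌉₊ : ℝ) + 1))) / T⌉₊ + 1 : ℕ) : ℝ≥0) := by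
      have h : (1 : ℝ≥0) ≤ ((⌈(((⌈T⌉₊ : ℝ) + 1) - (-((⌈T⌉₊ : ℝ) + 1))) / T⌉₊ + 1 : ℕ) : ℝ≥0) := by
        exact_mod_cast Nat.le_add_left 1 _
      exact h.trans (le_mul_of_one_le_left bot_le one_le_two)
    have h2 : C ≤ Cb := by
      rw [hCb]
      calc C = 1 * C := (one_mul C).symm
        _ ≤ _ := mul_le_mul_of_nonneg_right h1 bot_le
    exact_mod_cast h2
  set Ptot : ℝ≥0∞ := Cp * (((Cb : ℝ≥0∞) ^ (2 / 3 : ℝ) * ((SNormLESNormFDerivOfEqConst (EuclideanSpace ℝ (Fin 3)) (volume : Measure (EuclideanSpace ℝ (Fin 3))) 2 : ℝ≥0∞) ^ 2 * Cb)) +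
      ENNReal.ofReal T * ENNReal.ofReal α ^ (10 / 3 : ℝ) +
      (∫⁻ y, ‖η y‖ₑ) ^ (10 / 3 : ℝ) * ((Cb : ℝ≥0∞) ^ (2 / 3 : ℝ) * ((SNormLESNormFDerivOfEqConst (EuclideanSpace ℝ (Fin 3)) (volume : Measure (EuclideanSpace ℝ (Fin 3))) 2 : ℝ≥0∞) ^ 2 * Cb))) with hPtot
  have hPtot_top : Ptot ≠ ⊤ := by
    have hb1 : ((Cb : ℝ≥0∞) ^ (2 / 3 : ℝ) * ((SNormLESNormFDerivOfEqConst (EuclideanSpace ℝ (Fin 3)) (volume : Measure (EuclideanSpace ℝ (Fin 3))) 2 : ℝ≥0∞) ^ 2 * Cb)) ≠ ⊤ :=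
      ENNReal.mul_ne_top (ENNReal.rpow_ne_top_of_nonneg (by norm_num) ENNReal.coe_ne_top)
        (ENNReal.mul_ne_top (ENNReal.pow_ne_top ENNReal.coe_ne_top) ENNReal.coe_ne_top)
    refine ENNReal.mul_ne_top hCp (ENNReal.add_ne_top.2 ⟨ENNReal.add_ne_top.2 ⟨hb1, ?_⟩, ?_⟩)
    · exact ENNReal.mul_ne_top ENNReal.ofReal_ne_top (ENNReal.rpow_ne_top_of_nonneg (by norm_num) ENNReal.ofReal_ne_top)
    · exact ENNReal.mul_ne_top (ENNReal.rpow_ne_top_of_nonneg (by norm_num) hη.lintegral_enorm_lt_top.ne) hb1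
  refine ⟨Cb + Ptot.toNNReal, ?_⟩
  intro ε hε
  obtain ⟨U, G, hUm, hUsm, hUper, hGper, hUE, hG, hGb, hdiv, hiii⟩ :=
    exists_galerkin_limit_data hT hWr hη hε (C := C) (fun ha hdiv' hon => hC hε ha hdiv' hon)
  have hUE' : ∀ s, ∫⁻ y, ‖U s y‖ₑ ^ 2 ≤ (Cb : ℝ≥0∞) := fun s => (hUE s).trans hCCb
  have hGb' : ∫⁻ z in Ioo 0 T ×ˢ (univ : Set (EuclideanSpace ℝ (Fin 3))), ENNReal.ofReal (frobeniusNormSq (G z.1 z.2)) ≤ (Cb : ℝ≥0∞) := by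
    refine hGb.trans (le_of_eq ?_)
    rw [hCb]
    push_cast
    ring
  obtain ⟨p, hp⟩ := hP hT hα.le hWr hη hε (U := U) (G := G) (Cb := Cb) (Cx := Cb + Ptot.toNNReal) hUm hUsm hUper hGper
    hUE' hG hGb' hdiv hiii (by rw [ENNReal.coe_add]; exact le_self_add)
    (by rw [ENNReal.coe_add, ENNReal.coe_toNNReal hPtot_top]; exact le_add_self)
  exact ⟨U, p, hp⟩

end Discharge

end BradshawTsai2017

end Literature.Analysis.FluidPDE

end
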